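import Summits.AnomalousDissipation.AnomalousDissipation.Theorems.SolenoidalFractalHomogenisationLagrangianStepCellLawVOddGainDefectSpectral
import Summits.AnomalousDissipation.AnomalousDissipation.Theorems.SolenoidalFractalHomogenisationLagrangianStepCellLawVOddGainDefectSectorAtoms
import HarnessLib

/-!
# K1L `LagrangianRenormalisationStep(Design)` (K1L_D, stmt-AnomalousDissipation-27980; aside 24912), stub `stub_cellLawV0_IS`
# — W5 odd half, branch B of D24-16 (exact sector non-expansion of `f_T(B)`): PART 4/4 — THE COSINE MIXTURE (PROVED) and EXACT SECTOR NON-EXPANSION of `f_T(B)` (`θ = 1`)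

(planner ad-ideate-p5 g8, lens «profile»; text byte-for-byte from the crux workfile `Cruxes/LagrangianRenormalisationStep/OddGainDefectAutocorr.lean`
v2 = crux write 8ce4ef592c1f, split for the 400-line cap; lander: `--kind proof --supports stmt-AnomalousDissipation-27980 --as helper`).
NOT a proof of the stub, of the crux, of Onsager's conjecture or of anomalous dissipation — rung-leaf F-D1.A0 analysis.  No named facts, no sorry.
* §14 `slotSpec_le`, `integrable_slotSpec`, `CosineMixture`, **`cosineMixture_holds : 0 < ρ ≤ 1/2 → CosineMixture ρ`** (Fubini on `(0,∞)²`);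
* §15 `sectorPreservation_of_cosineMixture`, **`sectorPreservation_qsResp`** (`0<ρ≤1/2`, `T>0`, `B` coercive `τ`-sectorial ⇒ `(xᵀFz − zᵀFx)² ≤ τ²(xᵀFx)(zᵀFz)`, `F = qsResp ρ T B`).
Landed by prover ad-k3l-bookkeeping-p1 g5 from the planner's landing kit `HOME/ad-ideate-p5/k1l-odd-defect/split/` (bodies = crux text byte-for-byte;
gate-demanded one-line docstrings added; p5's closing corollary `form_qsResp_nonneg` OMITTED — that fqn is w1's p659899 `…CellLawVNonExpansion.form_qsResp_nonneg` (stronger: `T ≥ 0`, psd `B`, any `ρ`)).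
-/

set_option linter.dupNamespace false

namespace Summit.AnomalousDissipation.AnomalousDissipation.Theorems.SolenoidalFractalHomogenisation.LagrangianStep.OddGain

open MeasureTheory Set Matrix Literature.Analysis Literature.Analysis.FluidPDE Literature.Analysis.FluidPDE.LatticeShear
open Literature.Analysis.ODE.PeriodicAveraging

/-! ## §14 THE COSINE MIXTURE (PROVED): `xᵀ f_T(B) z = (T/π)∫₀^∞ Â_ρ(η)·xᵀ (TB)((TB)² + η²)⁻¹ z dη` -/

section Mixture

open scoped Real

/-- `slotSpec ρ η = trapSpec ρ (η/(2π))`. [folklore] -/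
theorem slotSpec_eq_trapSpec (ρ η : ℝ) : slotSpec ρ η = trapSpec ρ (η / (2 * π)) := by
  have h := slotSpec_two_pi_mul ρ (η / (2 * π))
  have hπ : (π : ℝ) ≠ 0 := Real.pi_ne_zero
  rw [show 2 * π * (η / (2 * π)) = η by field_simp] at h
  exact h

/-- The majorant `slotSpec ≤ 8π²(1 + η²)⁻¹` (`0 < ρ ≤ 1`). [folklore] -/
theorem slotSpec_le {ρ : ℝ} (hρ : 0 < ρ) (hρ1 : ρ ≤ 1) (η : ℝ) : slotSpec ρ η ≤ 8 * π ^ 2 * (1 + η ^ 2)⁻¹ := by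
  rw [slotSpec_eq_trapSpec]
  refine le_trans (trapSpec_le hρ hρ1 _) ?_
  rw [← div_eq_mul_inv, ← div_eq_mul_inv, div_le_div_iff₀ (by positivity) (by positivity)]
  have hπ : 1 ≤ π := by linarith [Real.pi_gt_three]
  have hπ0 : (π : ℝ) ≠ 0 := Real.pi_ne_zero
  have e : 8 * π ^ 2 * (1 + (η / (2 * π)) ^ 2) = 8 * π ^ 2 + 2 * η ^ 2 := by
    field_simp
    ring
  rw [e]
  nlinarith [sq_nonneg η]

/-- `slotSpec ρ` is measurable. [folklore] -/
theorem measurable_slotSpec (ρ : ℝ) : Measurable (fun η : ℝ => slotSpec ρ η) := by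
  unfold slotSpec
  fun_prop

/-- The slot spectral weight is integrable. [folklore] -/
theorem integrable_slotSpec {ρ : ℝ} (hρ : 0 < ρ) (hρ1 : ρ ≤ 1) : Integrable (fun η : ℝ => slotSpec ρ η) := by
  refine Integrable.mono' (integrable_inv_one_add_sq.const_mul (8 * π ^ 2)) (measurable_slotSpec ρ).aestronglyMeasurable
    (Filter.Eventually.of_forall fun η => ?_)
  rw [Real.norm_eq_abs, abs_of_nonneg (slotSpec_nonneg ρ η)]
  exact slotSpec_le hρ hρ1 η

/-- **THE COSINE MIXTURE** (the single analytic input of branch B of D24-16, typed in §9 of the sectorial-window memo): for `T > 0` and coercive `B`,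
the slot response is the nonnegative mixture of resolvent atoms `f_T(B) = (T/π)∫₀^∞ Â_ρ(η)·(TB)((TB)² + η²)⁻¹ dη` (weak form, with integrability). -/
def CosineMixture (ρ : ℝ) : Prop :=
  ∀ T : ℝ, 0 < T → ∀ (B : Matrix (Fin 3) (Fin 3) ℝ) (lo : ℝ), 0 < lo → (∀ x : Fin 3 → ℝ, lo * (x ⬝ᵥ x) ≤ x ⬝ᵥ B *ᵥ x) →
    ∀ x z : Fin 3 → ℝ,
      IntegrableOn (fun ξ : ℝ => slotSpec ρ ξ * (x ⬝ᵥ (resolventAtom (T • B) (ξ ^ 2)) *ᵥ z)) (Ioi 0) ∧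
      x ⬝ᵥ (qsResp ρ T B) *ᵥ z = T / Real.pi * ∫ ξ in Ioi 0, slotSpec ρ ξ * (x ⬝ᵥ (resolventAtom (T • B) (ξ ^ 2)) *ᵥ z)

/-- **THE COSINE MIXTURE HOLDS** for every profile parameter `0 < ρ ≤ 1/2`.  Proof: `xᵀf_T(B)z = T∫₀^∞ A(u)·xᵀe^{−uTB}z du` (§11),
`A(u) = (1/π)∫₀^∞ Â_ρ(η)cos(ηu)dη` (§13, Fourier inversion of `𝓕A = |𝓕a|²`), Fubini on `(0,∞)²` (majorant `Â_ρ(η)·e^{−Tλ₀u}|x||z|`), and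
the Laplace–cosine transform `∫₀^∞ cos(ηu)·xᵀe^{−uC}z du = xᵀC(C² + η²)⁻¹z` (§11). [folklore] -/
theorem cosineMixture_holds {ρ : ℝ} (hρ : 0 < ρ) (hρ2 : ρ ≤ 1 / 2) : CosineMixture ρ := by
  intro T hT B lo hlo hco x z
  have hTlo : 0 < T * lo := mul_pos hT hlo
  have hcoT : ∀ y : Fin 3 → ℝ, T * lo * (y ⬝ᵥ y) ≤ y ⬝ᵥ (T • B) *ᵥ y := by
    intro y
    rw [Matrix.smul_mulVec, dotProduct_smul, smul_eq_mul, mul_assoc]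
    exact mul_le_mul_of_nonneg_left (hco y) hT.le
  -- the time profile `F(u) = xᵀ e^{−u·TB} z`
  set F : ℝ → ℝ := fun u => x ⬝ᵥ (NormedSpace.exp (-(u • (T • B)))) *ᵥ z with hF
  have hFc : Continuous F := continuous_const.dotProduct (continuous_exp_neg_smul_mulVec (T • B) z)
  set K : ℝ := Real.sqrt (x ⬝ᵥ x) * Real.sqrt (z ⬝ᵥ z) with hK
  have hFb : ∀ u : ℝ, 0 ≤ u → |F u| ≤ Real.exp (-(T * lo * u)) * K := fun u hu => abs_form_exp_le hcoT x z hu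
  -- the joint integrand on `(0,∞)²`
  set G : ℝ × ℝ → ℝ := fun p => slotSpec ρ p.1 * (Real.cos (p.1 * p.2) * F p.2) with hG
  have hGm : AEStronglyMeasurable G ((volume.restrict (Ioi (0:ℝ))).prod (volume.restrict (Ioi (0:ℝ)))) := by
    refine Measurable.aestronglyMeasurable ?_
    exact ((measurable_slotSpec ρ).comp measurable_fst).mul
      ((Real.continuous_cos.measurable.comp (measurable_fst.mul measurable_snd)).mul (hFc.measurable.comp measurable_snd))
  have hGi : Integrable G ((volume.restrict (Ioi (0:ℝ))).prod (volume.restrict (Ioi (0:ℝ)))) := by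
    have hmaj : Integrable (fun p : ℝ × ℝ => slotSpec ρ p.1 * (Real.exp (-(T * lo) * p.2) * K))
        ((volume.restrict (Ioi (0:ℝ))).prod (volume.restrict (Ioi (0:ℝ)))) :=
      ((integrable_slotSpec hρ (by linarith)).integrableOn).mul_prod ((exp_neg_integrableOn_Ioi 0 hTlo).mul_const K)
    refine hmaj.mono' hGm ?_
    rw [Measure.prod_restrict]
    refine (ae_restrict_iff' (measurableSet_Ioi.prod measurableSet_Ioi)).2 (Filter.Eventually.of_forall fun p hp => ?_)
    have hu : 0 < p.2 := hp.2
    rw [Real.norm_eq_abs, hG]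
    simp only
    rw [abs_mul, abs_of_nonneg (slotSpec_nonneg ρ p.1), abs_mul]
    refine mul_le_mul_of_nonneg_left ?_ (slotSpec_nonneg ρ p.1)
    calc |Real.cos (p.1 * p.2)| * |F p.2| ≤ 1 * (Real.exp (-(T * lo * p.2)) * K) :=
          mul_le_mul (Real.abs_cos_le_one _) (hFb p.2 hu.le) (abs_nonneg _) zero_le_one
      _ = Real.exp (-(T * lo) * p.2) * K := by rw [one_mul, neg_mul]
  -- the inner `u`-integral, per frequency
  have inner : ∀ η : ℝ, ∫ u in Ioi (0:ℝ), G (η, u) = slotSpec ρ η * (x ⬝ᵥ (resolventAtom (T • B) (η ^ 2)) *ᵥ z) := by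
    intro η
    simp only [hG]
    rw [integral_const_mul, resolventAtom]
    congr 1
    exact (integral_Ioi_cos_mul_form_exp hTlo hcoT η x z).2
  -- `A(u)·F(u) = (1/π)∫_η G(η,u)`
  have hAu : ∀ u : ℝ, rampAutocorr ρ u * F u = 1 / π * ∫ η in Ioi (0:ℝ), G (η, u) := by
    intro u
    rw [rampAutocorr_eq_slotSpec_integral hρ hρ2 u, mul_assoc, ← integral_mul_const]
    congr 1
    refine integral_congr_ae (Filter.Eventually.of_forall fun η => ?_)
    simp only [hG]
    ring
  -- Fubini
  have hswap : ∫ u in Ioi (0:ℝ), ∫ η in Ioi (0:ℝ), G (η, u) = ∫ η in Ioi (0:ℝ), ∫ u in Ioi (0:ℝ), G (η, u) :=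
    integral_integral_swap (f := fun u η => G (η, u)) hGi.swap
  have hmain : x ⬝ᵥ (qsResp ρ T B) *ᵥ z =
      T / Real.pi * ∫ η in Ioi 0, slotSpec ρ η * (x ⬝ᵥ (resolventAtom (T • B) (η ^ 2)) *ᵥ z) := by
    rw [form_qsResp_eq_autocorr_Ioi hρ T B x z]
    have e1 : ∫ u in Ioi (0:ℝ), rampAutocorr ρ u * F u = 1 / π * ∫ u in Ioi (0:ℝ), ∫ η in Ioi (0:ℝ), G (η, u) := by
      rw [← integral_const_mul]
      exact integral_congr_ae (Filter.Eventually.of_forall hAu)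
    have e2 : ∫ η in Ioi (0:ℝ), ∫ u in Ioi (0:ℝ), G (η, u) =
        ∫ η in Ioi (0:ℝ), slotSpec ρ η * (x ⬝ᵥ (resolventAtom (T • B) (η ^ 2)) *ᵥ z) :=
      integral_congr_ae (Filter.Eventually.of_forall inner)
    rw [e1, hswap, e2]
    ring
  refine ⟨?_, hmain⟩
  exact (hGi.integral_prod_left).congr (Filter.Eventually.of_forall inner)

end Mixture

section SectorPreservation

/-- **L1⁺ FROM THE COSINE MIXTURE (PROVED): exact sector NON-EXPANSION of the slot response.**  If `CosineMixture ρ` holds then for `T > 0` and every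
coercive `τ`-sectorial block `B` (`lo > 0`), `F = f_T(B)` is `τ`-sectorial: `(xᵀFz − zᵀFx)² ≤ τ²(xᵀFx)(zᵀFz)` — i.e. `θ ≤ 1`, branch B of D24-16
(`ΛV` up to `1.10`) with NO loss.  (Atoms sector-safe + nonnegative weights + the discriminant trick.) -/
theorem sectorPreservation_of_cosineMixture {ρ : ℝ} (hCM : CosineMixture ρ) {T : ℝ} (hT : 0 < T)
    {B : Matrix (Fin 3) (Fin 3) ℝ} {τ lo : ℝ} (hlo : 0 < lo)
    (hsec : ∀ x z : Fin 3 → ℝ, (x ⬝ᵥ B *ᵥ z - z ⬝ᵥ B *ᵥ x) ^ 2 ≤ τ ^ 2 * ((x ⬝ᵥ B *ᵥ x) * (z ⬝ᵥ B *ᵥ z)))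
    (hco : ∀ x : Fin 3 → ℝ, lo * (x ⬝ᵥ x) ≤ x ⬝ᵥ B *ᵥ x) (x z : Fin 3 → ℝ) :
    (x ⬝ᵥ (qsResp ρ T B) *ᵥ z - z ⬝ᵥ (qsResp ρ T B) *ᵥ x) ^ 2 ≤
      τ ^ 2 * ((x ⬝ᵥ (qsResp ρ T B) *ᵥ x) * (z ⬝ᵥ (qsResp ρ T B) *ᵥ z)) := by
  set F := qsResp ρ T B with hF
  -- the scaled block `T • B` is coercive (`T·lo`) and `τ`-sectorial
  have hcoT : ∀ x : Fin 3 → ℝ, T * lo * (x ⬝ᵥ x) ≤ x ⬝ᵥ (T • B) *ᵥ x := by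
    intro y; rw [Matrix.smul_mulVec, dotProduct_smul, smul_eq_mul, mul_assoc]
    exact mul_le_mul_of_nonneg_left (hco y) hT.le
  have hsecT : ∀ x z : Fin 3 → ℝ, (x ⬝ᵥ (T • B) *ᵥ z - z ⬝ᵥ (T • B) *ᵥ x) ^ 2 ≤
      τ ^ 2 * ((x ⬝ᵥ (T • B) *ᵥ x) * (z ⬝ᵥ (T • B) *ᵥ z)) := by
    intro y w
    simp only [Matrix.smul_mulVec, dotProduct_smul, smul_eq_mul]
    have h := hsec y w
    have e : (T * (y ⬝ᵥ B *ᵥ w) - T * (w ⬝ᵥ B *ᵥ y)) ^ 2 = T ^ 2 * (y ⬝ᵥ B *ᵥ w - w ⬝ᵥ B *ᵥ y) ^ 2 := by ring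
    rw [e]
    calc T ^ 2 * (y ⬝ᵥ B *ᵥ w - w ⬝ᵥ B *ᵥ y) ^ 2 ≤ T ^ 2 * (τ ^ 2 * ((y ⬝ᵥ B *ᵥ y) * (w ⬝ᵥ B *ᵥ w))) :=
          mul_le_mul_of_nonneg_left h (sq_nonneg T)
      _ = τ ^ 2 * (T * (y ⬝ᵥ B *ᵥ y) * (T * (w ⬝ᵥ B *ᵥ w))) := by ring
  have hTlo : 0 < T * lo := mul_pos hT hlo
  -- pointwise atom facts
  have atom : ∀ ξ : ℝ, ∀ y w : Fin 3 → ℝ,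
      (y ⬝ᵥ (resolventAtom (T • B) (ξ ^ 2)) *ᵥ w - w ⬝ᵥ (resolventAtom (T • B) (ξ ^ 2)) *ᵥ y) ^ 2 ≤
        τ ^ 2 * ((y ⬝ᵥ (resolventAtom (T • B) (ξ ^ 2)) *ᵥ y) * (w ⬝ᵥ (resolventAtom (T • B) (ξ ^ 2)) *ᵥ w)) ∧
      0 ≤ y ⬝ᵥ (resolventAtom (T • B) (ξ ^ 2)) *ᵥ y :=
    fun ξ y w => sector_resolventAtom hTlo (sq_nonneg ξ) hsecT hcoT y w
  have hTpi : 0 ≤ T / Real.pi := div_nonneg hT.le Real.pi_pos.le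
  -- abbreviations for the integrands
  set Rξ : ℝ → Matrix (Fin 3) (Fin 3) ℝ := fun ξ => resolventAtom (T • B) (ξ ^ 2) with hRξ
  -- quadratic forms of F are nonnegative
  have hQnn : ∀ y : Fin 3 → ℝ, 0 ≤ y ⬝ᵥ F *ᵥ y := by
    intro y
    rw [hF, (hCM T hT B lo hlo hco y y).2]
    refine mul_nonneg hTpi (setIntegral_nonneg measurableSet_Ioi fun ξ _ => ?_)
    exact mul_nonneg (slotSpec_nonneg ρ ξ) (atom ξ y y).2
  -- the key family of inequalities: c·σ_F(x,z) ≤ τ'(c²Q_F(x) + Q_F(z))/2 with τ' = |τ|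
  have key : ∀ c : ℝ, c * (x ⬝ᵥ F *ᵥ z - z ⬝ᵥ F *ᵥ x) ≤ |τ| * ((c ^ 2 * (x ⬝ᵥ F *ᵥ x) + z ⬝ᵥ F *ᵥ z) / 2) := by
    intro c
    have I1 := hCM T hT B lo hlo hco (c • x) z
    have I2 := hCM T hT B lo hlo hco z (c • x)
    have I3 := hCM T hT B lo hlo hco (c • x) (c • x)
    have I4 := hCM T hT B lo hlo hco z z
    rw [← hF] at I1 I2 I3 I4
    have e1 : (c • x) ⬝ᵥ F *ᵥ z = c * (x ⬝ᵥ F *ᵥ z) := by rw [smul_dotProduct, smul_eq_mul]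
    have e2 : z ⬝ᵥ F *ᵥ (c • x) = c * (z ⬝ᵥ F *ᵥ x) := by rw [Matrix.mulVec_smul, dotProduct_smul, smul_eq_mul]
    have e3 : (c • x) ⬝ᵥ F *ᵥ (c • x) = c ^ 2 * (x ⬝ᵥ F *ᵥ x) := by
      rw [Matrix.mulVec_smul, smul_dotProduct, dotProduct_smul, smul_eq_mul, smul_eq_mul]; ring
    have lhs : c * (x ⬝ᵥ F *ᵥ z - z ⬝ᵥ F *ᵥ x) = T / Real.pi *
        ∫ ξ in Ioi 0, (slotSpec ρ ξ * ((c • x) ⬝ᵥ (Rξ ξ) *ᵥ z) - slotSpec ρ ξ * (z ⬝ᵥ (Rξ ξ) *ᵥ (c • x))) :=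
      calc c * (x ⬝ᵥ F *ᵥ z - z ⬝ᵥ F *ᵥ x) = (c • x) ⬝ᵥ F *ᵥ z - z ⬝ᵥ F *ᵥ (c • x) := by rw [e1, e2]; ring
        _ = T / Real.pi * (∫ ξ in Ioi 0, slotSpec ρ ξ * ((c • x) ⬝ᵥ (Rξ ξ) *ᵥ z)) -
              T / Real.pi * (∫ ξ in Ioi 0, slotSpec ρ ξ * (z ⬝ᵥ (Rξ ξ) *ᵥ (c • x))) := by rw [I1.2, I2.2]
        _ = _ := by rw [integral_sub I1.1 I2.1, mul_sub]
    have rhs : |τ| * ((c ^ 2 * (x ⬝ᵥ F *ᵥ x) + z ⬝ᵥ F *ᵥ z) / 2) = T / Real.pi *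
        ∫ ξ in Ioi 0, |τ| / 2 * (slotSpec ρ ξ * ((c • x) ⬝ᵥ (Rξ ξ) *ᵥ (c • x)) + slotSpec ρ ξ * (z ⬝ᵥ (Rξ ξ) *ᵥ z)) :=
      calc |τ| * ((c ^ 2 * (x ⬝ᵥ F *ᵥ x) + z ⬝ᵥ F *ᵥ z) / 2) = |τ| / 2 * ((c • x) ⬝ᵥ F *ᵥ (c • x) + z ⬝ᵥ F *ᵥ z) := by
            rw [e3]; ring
        _ = |τ| / 2 * (T / Real.pi * (∫ ξ in Ioi 0, slotSpec ρ ξ * ((c • x) ⬝ᵥ (Rξ ξ) *ᵥ (c • x))) +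
              T / Real.pi * (∫ ξ in Ioi 0, slotSpec ρ ξ * (z ⬝ᵥ (Rξ ξ) *ᵥ z))) := by rw [← I3.2, ← I4.2]
        _ = _ := by rw [integral_const_mul, integral_add I3.1 I4.1]; ring
    rw [lhs, rhs]
    refine mul_le_mul_of_nonneg_left ?_ hTpi
    refine setIntegral_mono_on (I1.1.sub I2.1) ((I3.1.add I4.1).const_mul _) measurableSet_Ioi fun ξ _ => ?_
    -- pointwise: Â·σ_R(cx, z) ≤ (|τ|/2)·Â·(Q_R(cx) + Q_R(z))
    have hA := slotSpec_nonneg ρ ξ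
    obtain ⟨hsq, hq1⟩ := atom ξ (c • x) z
    have hq2 := (atom ξ z z).2
    -- |σ| ≤ |τ| √(Q₁Q₂) ≤ |τ|(Q₁+Q₂)/2, via squares
    have hσ : (c • x) ⬝ᵥ (Rξ ξ) *ᵥ z - z ⬝ᵥ (Rξ ξ) *ᵥ (c • x) ≤
        |τ| / 2 * ((c • x) ⬝ᵥ (Rξ ξ) *ᵥ (c • x) + z ⬝ᵥ (Rξ ξ) *ᵥ z) := by
      have hsq' : ((c • x) ⬝ᵥ (Rξ ξ) *ᵥ z - z ⬝ᵥ (Rξ ξ) *ᵥ (c • x)) ^ 2 ≤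
          (|τ| / 2 * ((c • x) ⬝ᵥ (Rξ ξ) *ᵥ (c • x) + z ⬝ᵥ (Rξ ξ) *ᵥ z)) ^ 2 := by
        refine hsq.trans ?_
        have hτ2 : τ ^ 2 = |τ| ^ 2 := (sq_abs τ).symm
        rw [hτ2]
        nlinarith [sq_nonneg ((c • x) ⬝ᵥ (Rξ ξ) *ᵥ (c • x) - z ⬝ᵥ (Rξ ξ) *ᵥ z), sq_nonneg |τ|, abs_nonneg τ,
          mul_nonneg (sq_nonneg |τ|) (sq_nonneg ((c • x) ⬝ᵥ (Rξ ξ) *ᵥ (c • x) - z ⬝ᵥ (Rξ ξ) *ᵥ z))]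
      exact (abs_le_of_sq_le_sq' hsq' (by positivity)).2
    have := mul_le_mul_of_nonneg_left hσ hA
    nlinarith [this]
  have h := sq_le_of_forall_scale (hQnn x) (hQnn z) key
  rwa [sq_abs] at h


/-- **L1⁺ (UNCONDITIONAL): the quasi-static slot response does not expand the numerical-range sector.**  For `0 < ρ ≤ 1/2`, `T > 0` and every coercive
`τ`-sectorial block `B`, `F = f_T(B) = qsResp ρ T B` satisfies `(xᵀFz − zᵀFx)² ≤ τ²(xᵀFx)(zᵀFz)`.  (= `sectorPreservation_of_cosineMixture` ∘ `cosineMixture_holds`.)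
This is the `θ ≤ 1` input that opens branch B of tenure decision D24-16 (`ΛV` up to `1.10`). [folklore] -/
theorem sectorPreservation_qsResp {ρ : ℝ} (hρ : 0 < ρ) (hρ2 : ρ ≤ 1 / 2) {T : ℝ} (hT : 0 < T)
    {B : Matrix (Fin 3) (Fin 3) ℝ} {τ lo : ℝ} (hlo : 0 < lo)
    (hsec : ∀ x z : Fin 3 → ℝ, (x ⬝ᵥ B *ᵥ z - z ⬝ᵥ B *ᵥ x) ^ 2 ≤ τ ^ 2 * ((x ⬝ᵥ B *ᵥ x) * (z ⬝ᵥ B *ᵥ z)))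
    (hco : ∀ x : Fin 3 → ℝ, lo * (x ⬝ᵥ x) ≤ x ⬝ᵥ B *ᵥ x) (x z : Fin 3 → ℝ) :
    (x ⬝ᵥ (qsResp ρ T B) *ᵥ z - z ⬝ᵥ (qsResp ρ T B) *ᵥ x) ^ 2 ≤
      τ ^ 2 * ((x ⬝ᵥ (qsResp ρ T B) *ᵥ x) * (z ⬝ᵥ (qsResp ρ T B) *ᵥ z)) :=
  sectorPreservation_of_cosineMixture (cosineMixture_holds hρ hρ2) hT hlo hsec hco x z

end SectorPreservation

end Summit.AnomalousDissipation.AnomalousDissipation.Theorems.SolenoidalFractalHomogenisation.LagrangianStep.OddGain
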